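import Summits.BirchSwinnertonDyer.BirchSwinnertonDyer.Theorems.AlignedTransportAtTwoMainConjectureOfRankZeroBSDAtTwoCubicRelationDoor
import Literature.NumberTheory.IwasawaTheory.ClassicalMuVanishesLayerTwoInvariantClassCertificateTwo
import HarnessLib

/-!
# Route `AlignedTransportAtTwo`, crux C2 `MainConjectureOfRankZeroBSDAtTwo` (stmt-BirchSwinnertonDyer-22298):
# THE LAYER-TWO INVARIANT-CLASS DOOR IN COORDINATES — `μ₂ = 0`, `λ₂ ≤ 2`, `rank₂ Cl(K_m) ≤ 2 ∀ m` for the cubic `2`-torsion field `ℚ(β)` on the sub-cell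
# `Δ_min ≡ 5 (mod 8)`, `Δ_W < 0`, `h(ℚ(β))` odd, `t ≥ 3`, from ONE `Gal(K_2/K_1)`-INVARIANT class `σ²c = c` at layer `K_2 = ℚ(β)·ℚ(ζ₁₆)⁺` written in `𝓞_{ℚ(β)}`

HONEST FRAMING (cell `bsd-f1-sign2`, WIDTH-5 attached prover seat `bsd-line-att-p3` gen 51 on line `birth` of the lead `bsd-line-att-p2`;
`--supports` stmt-BirchSwinnertonDyer-22298, closes nothing; BSD is NOT proved by any of this; the crux C2, its verdict «blocked-on
`Rank1Residual.GreenbergMuConjectureIrreducible`» and every registered stub are untouched).  THEOREMS ONLY — no definition, no named fact, no `sorry`.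

WHAT.  The `W`-level form of this seat's Literature theorem `IwasawaTheory.classicalMuVanishes_two_of_invariantClassCert_layer_two` (the LAYER-TWO consumer of att-p3 g49's
t-free relation door `classicalMuVanishes_two_of_relation_of_genusCert_layer_anyDepth` with relation polynomial `X² − 1 = (X−1)²·1 + 2(X−1)`, `d = 2`; sister of att-p4 g43's
`…CubicLayerThreeRelationDoor`): `W` good ordinary at `2`, no rational `2`-torsion abscissa, `Δ_min ≡ 5 (8)`, `Δ_W < 0`, `β` a root of the `2`-division cubic, `K = ℚ(β)`
with `h_K` odd, `2 ∤ d_K`, `𝔭₁` of norm `2`, a unit `ε ≡ ±1 (mod 𝔭₁³)` with `±ε` non-squares (so `t ≥ 3`); and the ROW DATA in `𝓞_K`: `q₀` with `(q₀)` maximal and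
`q₀ ≡ ±3 (mod 𝔭₁³)`, `a ∈ ℤ`, a residue map `ψ : 𝓞_K → ℤ/q` (`q > 1`, `2` invertible) with `ψ(q₀) = 0` and `P₂(a) = (a²−2)²−2 = 0`, Bézout data `α q₀⁴ + β P₂(a) = q₀`, and ONE
element `y` of `K_2` (four `𝓞_K`-coordinates on `1, s₁, s₂, s₁s₂`) with `y = λq₀ + μ(s₂ − a)`, `y(s₂ + a) + q₀(kq₀ + n(s₂ − a)) = 0` and `N_{K_2/K}(y) = ε'q₀⁴` (tower-norm
templates `V₀, V₁`).  THEN for EVERY cyclotomic `ℤ₂`-extension `κ` of `ℚ(β)`: **`rank₂ Cl(K_m) ≤ 2 ∀ m`, `μ₂(κ) = 0`, `λ₂(κ) ≤ 2`.**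
Mechanism (Literature): `𝔠 = (q₀, s₂ − a)`, `σ² s₂ = −s₂`, `(y)·σ²𝔠 = (q₀)·𝔠` (two memberships + equal norms), `[σ²𝔠] = [𝔠]`, `N_{K_2/K} 𝔠 = (q₀)` — relation `X² − 1`.

CELL READING: the CONVERSE QUADRANT `t ≥ 4 ∧ e₁ ≥ 2` of the u7 sub-cell (where no door fired before this gen); first customer `N = 4307` (this gen's row
`…CubicLayerTwoInvariantClassRowN4307`: `μ₂ = 0 ∧ λ₂ ≤ 2`).  Nothing about any curve is asserted HERE; BSD is not proved; nothing is closed.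

References: [Washington1997] §13.1, §13.3 Prop. 13.22–13.23; [Lang1990] Ch. 13 §4 Lemma 4.1; [Gras2003] IV.4; [Fukuda1994] Thm. 1; [NeukirchANT1999] Ch. I §3, §8,
Ch. III (1.6)–(1.7); [Serre1973CourseArithmetic] Ch. III §1.2; [Cohen1993] §4.7, §6.5; tree: att-p3 g48/g49 `…CubicRelationDoor`, att-p4 g43's
`NumberFields/SqrtTwoTowerTwoGaloisAction`, this seat's `IwasawaTheory/ClassicalMuVanishesLayerTwoInvariantClassCertificateTwo`.
-/

set_option linter.dupNamespace false
set_option autoImplicit false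

noncomputable section

open scoped Classical NumberField nonZeroDivisors

namespace Summit.BirchSwinnertonDyer.BirchSwinnertonDyer.Theorems.AlignedTransportAtTwoCubicLayerTwoInvariantClassDoor

open NumberField IsDedekindDomain Polynomial WeierstrassCurve IntermediateField CongruenceSubgroup Finset
  Literature.NumberTheory.IwasawaTheory Literature.NumberTheory.GaloisRepresentations
  Literature.NumberTheory.GaloisRepresentations.Herbrand Literature.NumberTheory.GaloisRepresentations.MinkowskiUnit
  Literature.NumberTheory.GaloisRepresentations.CyclicNormIndex
  Literature.NumberTheory.EllipticCurves Literature.NumberTheory.EllipticCurves.Greenberg1999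
  Literature.NumberTheory.EllipticCurves.ModularForms
  Literature.NumberTheory.EllipticCurves.Rank1Residual
  Literature.NumberTheory.EllipticCurves.Module
  Literature.NumberTheory.NumberFields Literature.NumberTheory.NumberFields.AmbiguousClass
  Summit.BirchSwinnertonDyer.Rank1Residual
  Summit.BirchSwinnertonDyer.Rank1Residual.X1.MuLambda
  Summit.BirchSwinnertonDyer.Rank1Residual.X5
  Summit.BirchSwinnertonDyer.Rank1Residual.F1Sign2
  Summit.BirchSwinnertonDyer.BirchSwinnertonDyer.Theorems.Rank1ResidualX1Defs
  Summit.BirchSwinnertonDyer.BirchSwinnertonDyer.Theses.AlignedTransportAtTwo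
  Summit.BirchSwinnertonDyer.BirchSwinnertonDyer.Theorems.AlignedTransportAtTwoKilfordStratumShared
  Summit.BirchSwinnertonDyer.BirchSwinnertonDyer.Theorems.AlignedTransportAtTwoCubicCarrierRoad
  Summit.BirchSwinnertonDyer.BirchSwinnertonDyer.Theorems.AlignedTransportAtTwoCubicKilfordPrimes
  Summit.BirchSwinnertonDyer.BirchSwinnertonDyer.Theorems.AlignedTransportAtTwoCubicDepthDoorGenusCert
  Summit.BirchSwinnertonDyer.BirchSwinnertonDyer.Theorems.AlignedTransportAtTwoCubicPrimesOfEmbeddings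
  Summit.BirchSwinnertonDyer.BirchSwinnertonDyer.Theorems.AlignedTransportAtTwoCubicLayerOneDoors

variable (W : WeierstrassCurve ℚ) [W.IsElliptic] [W.IsGloballyMinimal]

set_option synthInstance.maxHeartbeats 400000 in
set_option maxHeartbeats 1600000 in
/-- **THE LAYER-TWO INVARIANT-CLASS DOOR IN COORDINATES** for the cubic `2`-torsion field `K = ℚ(β)` (`Δ_min ≡ 5 (8)`, `Δ_W < 0`, `h_K` odd, `2 ∤ d_K`, `t ≥ 3`): from
the displayed row data in `𝓞_K` (see the module docstring) — **`rank₂ Cl(K_m) ≤ 2 ∀ m`, `μ₂(κ) = 0`, `λ₂(κ) ≤ 2` for every cyclotomic `ℤ₂`-extension `κ` of `K`.**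
Two dyadic primes (`Δ_min ≢ 1 (8)`), `𝓞_K/𝔭₁ = 𝔽₂` and «all units `≡ ±1 (mod 𝔭₁³)`» (unit rank one, `±ε` non-squares) are derived as in att-p3's `…CubicRelationDoor`;
then this seat's `IwasawaTheory.classicalMuVanishes_two_of_invariantClassCert_layer_two`. [cite: Washington1997, §13.3 Prop. 13.22–13.23]
[cite: Lang1990, Ch. 13 §4, Lemma 4.1 (PDF pp. 203–204)] [cite: NeukirchANT1999, Ch. III (1.6)–(1.7)] [cite: Cohen1993, §4.7, §6.5] -/
theorem classicalMuVanishes_adjoin_of_invariantClassCert_layer_two (hord : IsOrdinaryAt W 2)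
    (ht : ∀ x : ℚ, ¬ HasRationalTwoTorsionX W x) (h85 : minimalDiscriminantInt W % 8 = 5) (hΔ : W.Δ < 0)
    {β : AlgebraicClosure ℚ} (hβ : aeval β W.twoTorsionPolynomial.toPoly = 0)
    (hh : haveI : FiniteDimensional ℚ ↥(IntermediateField.adjoin ℚ ({β} : Set (AlgebraicClosure ℚ))) :=
        IntermediateField.adjoin.finiteDimensional ((AlgebraicClosure.isAlgebraic ℚ).isAlgebraic β).isIntegral
      haveI : NumberField ↥(IntermediateField.adjoin ℚ ({β} : Set (AlgebraicClosure ℚ))) := NumberField.mk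
      ¬ 2 ∣ classNumber ↥(IntermediateField.adjoin ℚ ({β} : Set (AlgebraicClosure ℚ))))
    (hd : haveI : FiniteDimensional ℚ ↥(IntermediateField.adjoin ℚ ({β} : Set (AlgebraicClosure ℚ))) :=
        IntermediateField.adjoin.finiteDimensional ((AlgebraicClosure.isAlgebraic ℚ).isAlgebraic β).isIntegral
      haveI : NumberField ↥(IntermediateField.adjoin ℚ ({β} : Set (AlgebraicClosure ℚ))) := NumberField.mk
      ¬ (2 : ℤ) ∣ NumberField.discr ↥(IntermediateField.adjoin ℚ ({β} : Set (AlgebraicClosure ℚ))))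
    (𝔭₁ : Ideal (𝓞 ↥(IntermediateField.adjoin ℚ ({β} : Set (AlgebraicClosure ℚ)))))
    (hN : haveI : FiniteDimensional ℚ ↥(IntermediateField.adjoin ℚ ({β} : Set (AlgebraicClosure ℚ))) :=
        IntermediateField.adjoin.finiteDimensional ((AlgebraicClosure.isAlgebraic ℚ).isAlgebraic β).isIntegral
      haveI : NumberField ↥(IntermediateField.adjoin ℚ ({β} : Set (AlgebraicClosure ℚ))) := NumberField.mk
      Ideal.absNorm 𝔭₁ = 2)
    {ε : (𝓞 ↥(IntermediateField.adjoin ℚ ({β} : Set (AlgebraicClosure ℚ))))ˣ} (hε : (ε : 𝓞 ↥(IntermediateField.adjoin ℚ ({β} : Set (AlgebraicClosure ℚ)))) - 1 ∈ 𝔭₁ ^ 3 ∨ (ε : 𝓞 ↥(IntermediateField.adjoin ℚ ({β} : Set (AlgebraicClosure ℚ)))) + 1 ∈ 𝔭₁ ^ 3) (hnsq : ∀ z : (𝓞 ↥(IntermediateField.adjoin ℚ ({β} : Set (AlgebraicClosure ℚ))))ˣ, ε ≠ z ^ 2 ∧ ε ≠ -z ^ 2)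
    (κP : ZpExtension ↥(IntermediateField.adjoin ℚ ({β} : Set (AlgebraicClosure ℚ))) 2) (hκP : κP.IsCyclotomic)
        (q₀ : 𝓞 ↥(IntermediateField.adjoin ℚ ({β} : Set (AlgebraicClosure ℚ)))) (hq₀ : (Ideal.span {q₀}).IsMaximal) (hπ : q₀ - 3 ∈ 𝔭₁ ^ 3 ∨ q₀ + 3 ∈ 𝔭₁ ^ 3)
    (a : ℤ) {q : ℕ} (hq : 1 < q) (ψ : 𝓞 ↥(IntermediateField.adjoin ℚ ({β} : Set (AlgebraicClosure ℚ))) →+* ZMod q) (hψ : ψ q₀ = 0) {ti : ZMod q} (hti : 2 * ti = 1)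
    (hPa : (((a : ZMod q) ^ 2 - 2) ^ 2 - 2) = 0)
    (α β' : 𝓞 ↥(IntermediateField.adjoin ℚ ({β} : Set (AlgebraicClosure ℚ)))) (hBez : α * q₀ ^ 4 + β' * (((a : 𝓞 ↥(IntermediateField.adjoin ℚ ({β} : Set (AlgebraicClosure ℚ)))) ^ 2 - 2) ^ 2 - 2) = q₀)
    (y₀ y₁ y₂ y₃ l₀ l₁ l₂ l₃ m₀ m₁ m₂ m₃ k₀ k₁ k₂ k₃ n₀ n₁ n₂ n₃ : 𝓞 ↥(IntermediateField.adjoin ℚ ({β} : Set (AlgebraicClosure ℚ))))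
    (hy₀ : y₀ = l₀ * q₀ + (-(a : 𝓞 ↥(IntermediateField.adjoin ℚ ({β} : Set (AlgebraicClosure ℚ)))) * m₀ + 2 * m₂ + 2 * m₃))
    (hy₁ : y₁ = l₁ * q₀ + (-(a : 𝓞 ↥(IntermediateField.adjoin ℚ ({β} : Set (AlgebraicClosure ℚ)))) * m₁ + m₂ + 2 * m₃))
    (hy₂ : y₂ = l₂ * q₀ + (m₀ - (a : 𝓞 ↥(IntermediateField.adjoin ℚ ({β} : Set (AlgebraicClosure ℚ)))) * m₂))
    (hy₃ : y₃ = l₃ * q₀ + (m₁ - (a : 𝓞 ↥(IntermediateField.adjoin ℚ ({β} : Set (AlgebraicClosure ℚ)))) * m₃))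
    (hk₀ : (a : 𝓞 ↥(IntermediateField.adjoin ℚ ({β} : Set (AlgebraicClosure ℚ)))) * y₀ + 2 * y₂ + 2 * y₃ + q₀ * (k₀ * q₀ + (-(a : 𝓞 ↥(IntermediateField.adjoin ℚ ({β} : Set (AlgebraicClosure ℚ)))) * n₀ + 2 * n₂ + 2 * n₃)) = 0)
    (hk₁ : (a : 𝓞 ↥(IntermediateField.adjoin ℚ ({β} : Set (AlgebraicClosure ℚ)))) * y₁ + y₂ + 2 * y₃ + q₀ * (k₁ * q₀ + (-(a : 𝓞 ↥(IntermediateField.adjoin ℚ ({β} : Set (AlgebraicClosure ℚ)))) * n₁ + n₂ + 2 * n₃)) = 0)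
    (hk₂ : y₀ + (a : 𝓞 ↥(IntermediateField.adjoin ℚ ({β} : Set (AlgebraicClosure ℚ)))) * y₂ + q₀ * (k₂ * q₀ + (n₀ - (a : 𝓞 ↥(IntermediateField.adjoin ℚ ({β} : Set (AlgebraicClosure ℚ)))) * n₂)) = 0)
    (hk₃ : y₁ + (a : 𝓞 ↥(IntermediateField.adjoin ℚ ({β} : Set (AlgebraicClosure ℚ)))) * y₃ + q₀ * (k₃ * q₀ + (n₁ - (a : 𝓞 ↥(IntermediateField.adjoin ℚ ({β} : Set (AlgebraicClosure ℚ)))) * n₃)) = 0)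
    (V₀ V₁ : 𝓞 ↥(IntermediateField.adjoin ℚ ({β} : Set (AlgebraicClosure ℚ)))) (hV₀ : V₀ = y₀ ^ 2 + 2 * y₁ ^ 2 - 2 * y₂ ^ 2 - 4 * y₃ ^ 2 - 4 * y₂ * y₃)
    (hV₁ : V₁ = 2 * y₀ * y₁ - y₂ ^ 2 - 2 * y₃ ^ 2 - 4 * y₂ * y₃)
    (εy : (𝓞 ↥(IntermediateField.adjoin ℚ ({β} : Set (AlgebraicClosure ℚ))))ˣ) (hNy : V₀ ^ 2 - 2 * V₁ ^ 2 = εy * q₀ ^ 4) :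
    (∀ m, classGroupPRank κP m ≤ 2) ∧ ClassicalMuVanishes κP ∧ classicalLambda κP ≤ 2 := by
  have hirr := AlignedTransportAtTwoSeed.irr_two_of_forall_not_hasRationalTwoTorsionX W ht
  have hβint : IsIntegral ℚ β := ((AlgebraicClosure.isAlgebraic ℚ).isAlgebraic β).isIntegral
  haveI : FiniteDimensional ℚ ↥(IntermediateField.adjoin ℚ ({β} : Set (AlgebraicClosure ℚ))) := IntermediateField.adjoin.finiteDimensional hβint
  haveI : NumberField ↥(IntermediateField.adjoin ℚ ({β} : Set (AlgebraicClosure ℚ))) := NumberField.mk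
  haveI : Fact (Nat.Prime 2) := ⟨Nat.prime_two⟩
  have h3 : Module.finrank ℚ ↥(IntermediateField.adjoin ℚ ({β} : Set (AlgebraicClosure ℚ))) = 3 :=
    AddKatoTwo.finrank_adjoin_root_twoTorsionPolynomial_eq_three W hirr hβ
  have hodd3 : ¬ 2 ∣ Module.finrank ℚ ↥(IntermediateField.adjoin ℚ ({β} : Set (AlgebraicClosure ℚ))) := by rw [h3]; decide
  have hoddK : Odd (Module.finrank ℚ ↥(IntermediateField.adjoin ℚ ({β} : Set (AlgebraicClosure ℚ)))) :=
    Nat.odd_iff.mpr (Nat.two_dvd_ne_zero.mp hodd3)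
  have hrank : Units.rank ↥(IntermediateField.adjoin ℚ ({β} : Set (AlgebraicClosure ℚ))) = 1 :=
    units_rank_eq_one_of_nrRealPlaces_eq_one _ h3 (nrRealPlaces_adjoin_root_twoTorsionPolynomial_eq_one W hΔ hirr hβ)
  have h8 : minimalDiscriminantInt W % 8 ≠ 1 := by rw [h85]; decide
  have hs := (not_onKilfordStratumAtTwo_iff_minimalDiscriminantInt_emod_eight_ne W hord).mpr h8
  have h2 := ncard_eq_two_of_not_onKilfordStratumAtTwo ↥(IntermediateField.adjoin ℚ ({β} : Set (AlgebraicClosure ℚ))) W hord ht h3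
    (AlignedTransportAtTwoCubicKilfordPrimes.aeval_four_mul_gen_twoDivisionUCubic W hβ) hs
  obtain ⟨h𝔭₁, hP0, h2P, hcard⟩ := isPrime_and_mem_of_absNorm_eq_two 𝔭₁ hN
  haveI := h𝔭₁
  haveI : 𝔭₁.IsMaximal := h𝔭₁.isMaximal hP0
  have hres := forall_mem_or_sub_one_mem_of_card_quotient_eq_two 𝔭₁ hcard
  have h2P' : (2 : 𝓞 ↥(IntermediateField.adjoin ℚ ({β} : Set (AlgebraicClosure ℚ)))) ∉ 𝔭₁ ^ 2 := two_not_mem_sq_of_not_dvd_discr hd 𝔭₁ h2P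
  have hunits := forall_units_sub_one_mem_or_add_one_mem_of_rank_eq_one hoddK hrank 𝔭₁ hP0 hres h2P h2P' hε hnsq
  exact classicalMuVanishes_two_of_invariantClassCert_layer_two hodd3 hd κP hκP h2 hh 𝔭₁ hres h2P hunits q₀ hq₀ hπ a hq ψ hψ hti hPa α β' hBez
    y₀ y₁ y₂ y₃ l₀ l₁ l₂ l₃ m₀ m₁ m₂ m₃ k₀ k₁ k₂ k₃ n₀ n₁ n₂ n₃ hy₀ hy₁ hy₂ hy₃ hk₀ hk₁ hk₂ hk₃ V₀ V₁ hV₀ hV₁ εy hNy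

end Summit.BirchSwinnertonDyer.BirchSwinnertonDyer.Theorems.AlignedTransportAtTwoCubicLayerTwoInvariantClassDoor

end
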